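import Mathlib
import Summits.Ventures.HodgeRepro2.B3Hilbert90

/-!
# B3UnitRefinement — Hilbert 90 at the unit level for an unramified-type valuation
(T4-B3 §B2(d)(ii)–(iii), E8 / E31: «norm-one units are quotients of units at unramified places»)

T4-B3 §B2(d) (route/T4-B3-p2.md l. 25) uses, at a non-split place `v` with `E_v/F_v` unramified:
«if moreover `E_v/F_v` is unramified and `y_v` is a unit, `e_v` can be taken a unit:
`Ĥ^{-1}(Gal(E_v/F_v), O_{E_v}^×) = 1`» (Neukirch CFT II (4.3) / Serre LCFT VI §1.2 Prop. 1), the one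
item of §B2(d) that `B3Hilbert90.lean` (file 17) left as prose. This file records the elementary
argument behind it: Hilbert 90 gives `y = e / c(e)` for some `e ≠ 0`; in the unramified case a
uniformiser `π` of `F_v` is a uniformiser of `E_v` fixed by `c`, so `e = π^k · u` with `u` a unit
and `y = u / c(u)`.

Abstractly, for a field `L` with a valuation `v` (into any linearly ordered group with zero),
an automorphism `c`, and an element `π` fixed by `c` whose value generates the value group
(`∀ e ≠ 0, ∃ k : ℤ, v e = v π ^ k` — «`π` is a common uniformiser», the unramified hypothesis;
the converse inclusion `mul_conj_eq_one_of_eq_div_conj` uses that `c` preserves `v`):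

* `exists_unit_div_conj_of_eq_div_conj` — if `y = e / c(e)` with `e ≠ 0`, then `y = u / c(u)`
  with `v u = 1`;
* **`exists_unit_div_conj_of_mul_conj_eq_one`** — for an involution `c ≠ id`: every `y` with
  `y · c(y) = 1` is `u / c(u)` with `v u = 1` (Hilbert 90 for norm-one elements, at the unit
  level: `Ĥ^{-1}(⟨c⟩, O^×) = 1` in its elementary form).

Nothing about local fields, Galois cohomology or adèles is formalised: `L` is any field with a
valuation, `c` any valuation-preserving involution.
-/

namespace Summit.Ventures.HodgeRepro2.ShimuraData.B3UnitRefinement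

variable {L : Type*} [Field L] {Γ : Type*} [LinearOrderedCommGroupWithZero Γ]

/-- **The unit refinement.** If `y = e / c(e)` with `e ≠ 0` and `π` is a `c`-fixed common
uniformiser (`v e = v π ^ k` for some `k : ℤ`), then `y = u / c(u)` for the unit `u = e / π^k`. -/
theorem exists_unit_div_conj_of_eq_div_conj (v : Valuation L Γ) (c : L ≃+* L)
    {π : L} (hπ : π ≠ 0) (hcπ : c π = π)
    (hdisc : ∀ e : L, e ≠ 0 → ∃ k : ℤ, v e = v π ^ k) {y e : L} (he : e ≠ 0)
    (hy : y = e / c e) : ∃ u : L, v u = 1 ∧ y = u / c u := by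
  obtain ⟨k, hk⟩ := hdisc e he
  have hvπ : v π ≠ 0 := (Valuation.ne_zero_iff v).mpr hπ
  have hπk : π ^ k ≠ 0 := zpow_ne_zero k hπ
  refine ⟨e / π ^ k, ?_, ?_⟩
  · rw [map_div₀, map_zpow₀, hk, div_self (zpow_ne_zero k hvπ)]
  · rw [hy, map_div₀, map_zpow₀, hcπ, div_div_div_cancel_right₀ hπk]

/-- **Hilbert 90 at the unit level.** For an involution `c ≠ id` and a `c`-fixed common
uniformiser `π`: every `y` with `y · c(y) = 1` is `u / c(u)` with `v u = 1`. -/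
theorem exists_unit_div_conj_of_mul_conj_eq_one (v : Valuation L Γ) (c : L ≃+* L)
    (hc : ∀ x, c (c x) = x) (hne : ∃ a, c a ≠ a) {π : L}
    (hπ : π ≠ 0) (hcπ : c π = π) (hdisc : ∀ e : L, e ≠ 0 → ∃ k : ℤ, v e = v π ^ k) {y : L}
    (hy : y * c y = 1) : ∃ u : L, v u = 1 ∧ y = u / c u := by
  obtain ⟨e, he, hye⟩ := B3Hilbert90.exists_div_conj_of_mul_conj_eq_one c hc hne hy
  exact exists_unit_div_conj_of_eq_div_conj v c hπ hcπ hdisc he hye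

/-- A unit quotient `u / c(u)` is itself a norm-one unit: the converse inclusion. -/
theorem mul_conj_eq_one_of_eq_div_conj (v : Valuation L Γ) (c : L ≃+* L)
    (hvc : ∀ x, v (c x) = v x) (hc : ∀ x, c (c x) = x) {u y : L} (hu : v u = 1)
    (hy : y = u / c u) : y * c y = 1 ∧ v y = 1 := by
  have hu0 : u ≠ 0 := by
    intro h0
    rw [h0, map_zero] at hu
    exact zero_ne_one hu
  have hcu0 : c u ≠ 0 := (map_ne_zero c).mpr hu0
  constructor
  · rw [hy, map_div₀, hc u, div_mul_div_comm, mul_comm u (c u), div_self (mul_ne_zero hcu0 hu0)]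
  · rw [hy, map_div₀, hvc, hu, div_one]

end Summit.Ventures.HodgeRepro2.ShimuraData.B3UnitRefinement
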